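import Mathlib
import Literature.Computability.AlgebraicComplexity.HessianAtOrigin
import Literature.Computability.AlgebraicComplexity.LRPencilOfMatrix
import Literature.Computability.AlgebraicComplexity.LandsbergRessayreNormalForm
import Literature.Computability.AlgebraicComplexity.AlperBogartVelascoLowOrder
import Summits.ValiantsHypothesis.ValiantsHypothesis.Theses.RefutationDegree

/-!
# The Hessian at the origin of `det (Λ_{i₀} + Z(x))` (line `Sketch`, crux `BeyondHessianNs`)

Helper file for crux item stmt-ValiantsHypothesis-5641 (`RefutationDegree.BeyondHessianNs`).

For a square matrix `B` of AFFINE linear forms with constant part `Λ_{i₀}` (`lamMatrix K i₀`: the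
identity matrix with the diagonal entry `(i₀, i₀)` replaced by `0`) and linear part
`Z(x) = Σ_a x_a Z(a)` (`Z(a) = LRPencil.coeffMat B a`), the coefficient of `x_a x_b` in `det B`,
i.e. the entry `(a, b)` of the Hessian at the origin `hess0 (det B)`, is

  `Z(a)_{i₀i₀} · tr' Z(b) + Z(b)_{i₀i₀} · tr' Z(a) - Σ_{s ≠ i₀} (Z(a)_{i₀ s} Z(b)_{s i₀} + Z(b)_{i₀ s} Z(a)_{s i₀})`

with `tr'` the trace off the index `i₀`.  This is the tree's
`AlperBogartVelasco.constantCoeff_pderiv_pderiv_det` (the case `Z(·)_{i₀i₀} = 0` of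
Alper–Bogart–Velasco, proof of Thm. 1.2) with the `Z_{i₀i₀}` terms kept: expand
`∂_a ∂_b det B` row by row (`AlperBogartVelasco.pderiv_pderiv_det_eq`), take constant terms, and
evaluate the determinants of `Λ_{i₀}` with two rows replaced — only the pairs of rows containing
`i₀` survive, each a `2 × 2` minor (`AlperBogartVelasco.det_lamMatrix_updateRow_self_updateRow`).
-/

noncomputable section

-- `Summit.ValiantsHypothesis.ValiantsHypothesis.…` is the tree's mandated single-conjunct layout.
set_option linter.dupNamespace false

namespace Summit.ValiantsHypothesis.ValiantsHypothesis.Theorems.RefutationDegreeBeyondHessianNs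

open MvPolynomial Matrix
open Literature.Computability.AlgebraicComplexity

/-- **Hessian at the origin of `det (Λ_{i₀} + Z(x))`**: for a matrix `B` of affine linear forms
with constant part `Λ_{i₀}`, the coefficient of `x_a x_b` in `det B` is
`Z(a)_{i₀i₀} · tr' Z(b) + Z(b)_{i₀i₀} · tr' Z(a) - Σ_{s ≠ i₀} (Z(a)_{i₀ s} Z(b)_{s i₀} + Z(b)_{i₀ s} Z(a)_{s i₀})`
(`Z(a) = coeffMat B a`, `tr'` = trace off `i₀`); only the pairs of replaced rows containing `i₀`
survive in the row-by-row expansion of `∂_a ∂_b det B` at the origin, each a `2 × 2` minor.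
[folklore] -/
theorem stub_hess0_det_lamMatrix {K : Type*} [Field K] {ι : Type*} [Fintype ι] [DecidableEq ι]
    {o : Type*} [Fintype o] [DecidableEq o] (B : Matrix o o (MvPolynomial ι K))
    (hB1 : ∀ r j, (B r j).totalDegree ≤ 1) (i₀ : o) (hB0 : constPart B = lamMatrix K i₀) (a b : ι) :
    hess0 B.det a b =
      LRPencil.coeffMat B a i₀ i₀ * (∑ s ∈ Finset.univ.erase i₀, LRPencil.coeffMat B b s s) +
      LRPencil.coeffMat B b i₀ i₀ * (∑ s ∈ Finset.univ.erase i₀, LRPencil.coeffMat B a s s) -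
      ∑ s ∈ Finset.univ.erase i₀,
        (LRPencil.coeffMat B a i₀ s * LRPencil.coeffMat B b s i₀ +
          LRPencil.coeffMat B b i₀ s * LRPencil.coeffMat B a s i₀) := by
  rw [hess0_apply, AlperBogartVelasco.pderiv_pderiv_det_eq hB1 b a, map_sum]
  simp_rw [map_sum]
  -- constant terms: determinants of `Λ_{i₀}` with the rows `r` (by `Z(b)_r`) and `s` (by `Z(a)_s`)
  -- replaced
  have hterm : ∀ r s, constantCoeff (((B.updateRow r fun j => C (LRPencil.coeffMat B b r j)).updateRow
      s fun j => C (LRPencil.coeffMat B a s j)).det) =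
      (((lamMatrix K i₀).updateRow r (LRPencil.coeffMat B b r)).updateRow s
        (LRPencil.coeffMat B a s)).det := by
    intro r s
    rw [RingHom.map_det, RingHom.mapMatrix_apply, map_updateRow, map_updateRow,
      show B.map ⇑constantCoeff = constPart B from rfl, hB0]
    congr 2
    · congr 1
      funext j
      simp
    · funext j
      simp
  simp_rw [hterm]
  -- the `2 × 2` minors: only the pairs `{r, s} ∋ i₀` survive
  have hD : ∀ r s, s ≠ r →
      (((lamMatrix K i₀).updateRow r (LRPencil.coeffMat B b r)).updateRow s
        (LRPencil.coeffMat B a s)).det =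
        if r = i₀ then LRPencil.coeffMat B b i₀ i₀ * LRPencil.coeffMat B a s s -
            LRPencil.coeffMat B b i₀ s * LRPencil.coeffMat B a s i₀
        else if s = i₀ then LRPencil.coeffMat B a i₀ i₀ * LRPencil.coeffMat B b r r -
            LRPencil.coeffMat B a i₀ r * LRPencil.coeffMat B b r i₀ else 0 := by
    intro r s hsr
    split_ifs with hr hs
    · subst hr
      exact AlperBogartVelasco.det_lamMatrix_updateRow_self_updateRow hsr _ _
    · subst hs
      rw [updateRow_comm _ hr, AlperBogartVelasco.det_lamMatrix_updateRow_self_updateRow hr]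
    · exact AlperBogartVelasco.det_lamMatrix_updateRow_updateRow_of_ne hr hs _ _
  have hinner : ∀ r, ∑ s ∈ Finset.univ.erase r,
      (((lamMatrix K i₀).updateRow r (LRPencil.coeffMat B b r)).updateRow s
        (LRPencil.coeffMat B a s)).det =
      ∑ s ∈ Finset.univ.erase r,
        (if r = i₀ then LRPencil.coeffMat B b i₀ i₀ * LRPencil.coeffMat B a s s -
            LRPencil.coeffMat B b i₀ s * LRPencil.coeffMat B a s i₀
        else if s = i₀ then LRPencil.coeffMat B a i₀ i₀ * LRPencil.coeffMat B b r r -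
            LRPencil.coeffMat B a i₀ r * LRPencil.coeffMat B b r i₀ else 0) :=
    fun r => Finset.sum_congr rfl fun s hs => hD r s (Finset.mem_erase.1 hs).1
  simp_rw [hinner]
  rw [← Finset.add_sum_erase _ _ (Finset.mem_univ i₀)]
  simp only [if_true]
  -- the terms `r ≠ i₀`: only `s = i₀` contributes
  have hrest : ∀ r ∈ Finset.univ.erase i₀, ∑ s ∈ Finset.univ.erase r,
      (if r = i₀ then LRPencil.coeffMat B b i₀ i₀ * LRPencil.coeffMat B a s s -
            LRPencil.coeffMat B b i₀ s * LRPencil.coeffMat B a s i₀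
        else if s = i₀ then LRPencil.coeffMat B a i₀ i₀ * LRPencil.coeffMat B b r r -
            LRPencil.coeffMat B a i₀ r * LRPencil.coeffMat B b r i₀ else 0) =
      LRPencil.coeffMat B a i₀ i₀ * LRPencil.coeffMat B b r r -
        LRPencil.coeffMat B a i₀ r * LRPencil.coeffMat B b r i₀ := by
    intro r hr
    have hri : r ≠ i₀ := (Finset.mem_erase.1 hr).1
    simp only [hri, if_false]
    rw [Finset.sum_ite_eq' (Finset.univ.erase r) i₀,
      if_pos (Finset.mem_erase.2 ⟨Ne.symm hri, Finset.mem_univ _⟩)]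
  rw [Finset.sum_congr rfl hrest, Finset.sum_sub_distrib, Finset.sum_sub_distrib,
    ← Finset.mul_sum, ← Finset.mul_sum, Finset.sum_add_distrib]
  ring

end Summit.ValiantsHypothesis.ValiantsHypothesis.Theorems.RefutationDegreeBeyondHessianNs
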